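import Summits.AnomalousDissipation.AnomalousDissipation.Theses.TameRoughRigidity
import Summits.AnomalousDissipation.AnomalousDissipation.Theorems.TaylorCertificatesSteadyStatesLoudBoundedStubGpAdmissible
import Literature.Analysis.FluidPDE.CylindricalGenerator
import HarnessLib

/-!
# Line `cutoff-compactness` — crux `TameRoughRigidity.TameClosure` (stmt-AnomalousDissipation-18402)

Route `route-AnomalousDissipation-TameRoughRigidity`, crux K (#4, TAME CLOSURE): for the pinned
Galloway–Proctor force `f_GP` and every energy level `E` and mean-enstrophy level `G₁`, if for every
`r > 0` there is a Borel probability measure on `H = L²_σ(T³)` with integrable energy, mean energy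
`≤ E`, mean enstrophy `≤ G₁` and Φ-uniform cylindrical forced-Euler defect
`|∫ ⟨f − B(v,v), Φ'(v)⟩ dμ| ≤ r (∫ ‖∇Φ'(v)‖² dμ)^{1/2}`, then `f_GP` carries an exact stationary
statistical solution of forced Euler (FMRT: probability, finite mean enstrophy, cylindrical Liouville
identity, shell energy inequality) with the same two bounds.

Registered by the crux-strategist seat `planner-cstrat-stmt-AnomalousDissipation-18402-b1-0`
(2026-08-17). TECHNIQUE WITH TEETH (lens `transfer`): the Galerkin CUT-OFF CYLINDRICAL TESTS
`Ψ_{K,ρ}(v) = χ(|P_K v|²/ρ) Φ(v)` of Foias–Manley–Rosa–Temam's proof of the two-dimensional energy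
equation (FMRT 2001 Ch. IV App. B.1, `Φ(u) = ψ(|P_m u|²)`; FORMALISED in the tree as
`Literature.Analysis.FluidPDE.Torus.galerkinTest` / `grad_galerkinTest` /
`IsStationaryStatisticalSolution.energy_eq_holds`, file `StatisticalSolutionEnergyEq.lean`), transplanted
from "energy equation of ONE stationary statistics in `d = 2`" to "closedness of NEAR-stationary
statistics in `d = 3` AT BOUNDED MEAN ENSTROPHY". The 2-D input that fails in 3-D (Ladyzhenskaya /
finite enstrophy of a.e. field controls the cubic term) is replaced by the TAME hypothesis: mean
enstrophy `≤ G₁` gives the class-uniform tail bound `∫ |Q_K v|² dν ≤ G₁/(4π²K²)`, which is exactly what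
kills the "Reynolds stress at infinity" (the σ of the lead's analysis in
`Cruxes/GPStatisticalRigidity/Lines/Sketch.md`): writing `v = P_K v + Q_K v`,

  `⟨B(v,v), g⟩ = Q_g(P_K v, P_K v) + T_g(v)`, `|T_g(v)| ≤ 3‖∇g‖_∞ |v| |Q_K v|`,
  so `∫ |T_g| dν ≤ 3‖∇g‖_∞ √E √G₁ /(2πK)` UNIFORMLY on the tame class (this is where tameness is used);
  `Q_g(P_K v, P_K v)` is bounded by `2ρ‖∇g‖_∞` on the support of the cut-off (bounded continuous part);
  the cut-off's own contribution `(2/ρ) χ'(|P_K v|²/ρ) Φ(v) ⟨f − B(v,v), P_K v⟩` is `O(ρ^{-1/2})`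
  because `b(v, P_K v, P_K v) = 0` by weak incompressibility (tree:
  `Torus.inertialPairing_fourierTruncate_eq`, general `d`) leaves `b(v, P_K v, Q_K v)`, bounded by
  `C_K |P_K v| |v| |Q_K v| ≤ C_K √(2ρ) |v|²` on `{ρ ≤ |P_K v|² ≤ 2ρ}` for ANY finite-dimensional
  (Bernstein) constant `C_K` — no particular growth rate in `K` is needed, `ρ → ∞` at fixed `K`;
  and the tail of the LIMIT measure `∫_{|v|² ≥ ρ} A(1+|v|²) dμ∞ → 0` needs no uniformity at all.

Hence `|∫ L₀Φ dμ∞| ≤ 2τ(K) + O_K(ρ^{-1/2}) + tail_{μ∞}(ρ)`; `ρ → ∞` then `K → ∞` gives the Liouville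
identity of the weak limit. The other three steps are standard and their engines are in the tree:
tightness + subsequence (Chebyshev on the mean enstrophy, Rellich `Torus.isCompact_setOf_eGradNormSq_le`,
Mathlib Prokhorov `isCompact_closure_of_isTightMeasureSet`, Lévy–Prokhorov metrisability; lsc of energy
and of the spectral enstrophy `Torus.lowerSemicontinuous_eGradNormSq_coe`), and the shell inequality by
time-reversal symmetrisation `½(μ + (v ↦ −v)_* μ)` (tools of `Theorems/…GPStatisticalRigidityDesaturation.lean`).

## Stubs (7 after the lead's reshape of S2 into S2a–S2d, 2026-08-17) and composition

* `stub_tightLimit` (S1, M–L) — TIGHT LIMIT: a sequence of probability measures on `H` with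
  integrable energy `≤ E` and mean enstrophy `≤ G₁` has a subsequence converging against bounded
  continuous observables to a probability measure with integrable energy `≤ E` and mean enstrophy `≤ G₁`.
* `stub_cutoffScheme` (S2, L, THE FLUID CONTENT, hardest) — CUT-OFF SCHEME ON THE TAME CLASS: for a
  smooth force `f`, a cylindrical `Φ`, levels `E, G₁` and `ε > 0` there is `ρ₀` such that for every
  `ρ ≥ ρ₀` there are a continuous cut-off `c : H → [0,1]`, `c = 1` on `{|v|² ≤ ρ}`, a bounded
  continuous `h : H → ℝ`, a cylindrical `Ψ` and `δ > 0` with, for EVERY probability `ν` of the tame class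
  `(E, G₁)`: `|∫ c·L₀Φ dν − ∫ h dν| ≤ ε`, and `|∫ c·L₀Φ dν| ≤ ε` as soon as the defect of `ν` at `Ψ` is
  `≤ δ (∫‖∇Ψ'‖² dν)^{1/2}` (take `c = χ(|P_K v|²/ρ)`, `h = c · (PP-part of L₀Φ)`, `Ψ = Ψ_{K,ρ}`,
  `K = K(ε)`, `ρ₀ = ρ₀(ε, K)` as above).
* `stub_limitExact` (S3, M) — ABSTRACT LIMIT LEMMA: if `μ_n → μ∞` against bounded continuous
  observables, `μ∞` has integrable energy, `F : H → ℝ` is continuous with `|F| ≤ A(1+|v|²)`, and for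
  every `ε` a scheme `(c, h)` as in S2 exists with the three inequalities (`μ∞`-approximation,
  `μ_n`-approximation, eventual smallness of `∫ c F dμ_n`), then `F ∈ L¹(μ∞)` and `∫ F dμ∞ = 0`
  (tail by dominated convergence for the single measure `μ∞`, then an `ε/4` argument).
* `stub_symmetrise` (S4, M) — TIME-REVERSAL NORMAL FORM: a probability measure with integrable energy
  `≤ E`, mean enstrophy `≤ G₁` and the exact cylindrical Liouville identity for forced Euler yields a
  stationary statistical solution (FMRT) with the same bounds: `μ' = ½(μ + (−)_*μ)` keeps the (even in
  `v`, linear in `μ`) identity and has zero shell work, finite enstrophy from `≤ G₁`.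
* `tameClosureSmooth_of_pieces : S1-sig → S2-sig → S3-sig → S4-sig → (tame closure for EVERY smooth
  force f)` — SORRY-FREE composition (approximants at `r = 1/(n+1)`, S1, then S3 fed by S2 on the
  subsequence — the defect radius `1/(φ n + 1)` is eventually `≤ δ` —, continuity and quadratic growth
  of `L₀Φ` from the tree (`Torus.continuous_nsGeneratorPairing_grad`,
  `Torus.exists_abs_nsGeneratorPairing_grad_le`), then S4). Nothing in K is specific to `f_GP`.
* `TameClosure_of : TameClosure` — the crux BY NAME (the only theorem of that type): pin the force
  (smooth by the landed `stub_gpAdmissible`) and apply `tameClosureSmooth_of_pieces` to the four stubs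
  (sorries ONLY inside `stub_*`).

## Disproof used

No `Cruxes/TameClosure/Disproof.lean` is published at registration time (crux dir empty). The refuter's
crux-attack note (item 18402, 2026-08-17T05:31Z; mutation file `Theorems/TameClosure/Negative/LoadBearing.lean`,
proposal p143453 pending) records: probability of the approximants LOAD-BEARING — used by S1 (tightness
of probability measures; mass conservation in the limit); defect clause LOAD-BEARING — used at S2/S3
(the eventual-smallness clause is the only place the near-stationarity enters); `Integrable |v|²`
clauses redundant given finite enstrophy (harmless; carried verbatim); conclusion false below `3/(4π)`
where the hypothesis is void (consistent: the composition only ever builds `μ∞` from actual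
approximants). The lead's σ-obstruction ("NoExact ⇒ must prove σ = 0", `Cruxes/GPStatisticalRigidity/Lines/Sketch.md`)
is answered by S2: σ is invisible to cut-off tests and the tame tail bound makes the un-cut remainder
uniformly small.

## References

* C. Foias, O. Manley, R. Rosa, R. Temam, *Navier–Stokes Equations and Turbulence* (CUP 2001), Ch. IV
  §1.2 Def. 1.3 (1.29)–(1.31); §3.1 Prop. 3.1 (tightness by enstrophy); App. B.1–B.2 (Galerkin cut-off
  tests, (B.17)). [FoiasManleyRosaTemam2001]
* D. Chae, The vanishing viscosity limit of statistical solutions of the Navier–Stokes equations,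
  J. Math. Anal. Appl. (1991), doi:10.1016/0022-247x(91)90013-p (2-D sibling: inviscid limits of
  stationary statistical solutions are Euler statistics).
* P. Constantin, A. Tarfulea, V. Vicol, arXiv:1305.7089 §§4–7 (2-D inviscid limits of SSS with uniform bounds).
* C. Foias, R. Rosa, R. Temam, arXiv:1411.3391 (convergence of time averages / SSS of 3-D NSE).
* P. Billingsley, *Convergence of Probability Measures*, 2nd ed., Thm. 5.1 (Prokhorov).
-/

-- `Summit.<Summit>.<Problem>` is the tree's mandated summit-side namespace (CONVENTIONS §2); single-conjunct summit.
set_option linter.dupNamespace false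

noncomputable section

namespace Summit.AnomalousDissipation.AnomalousDissipation.Cruxes.TameClosure.CutoffCompactness

open MeasureTheory Filter Topology UnitAddTorus
open scoped InnerProductSpace RealInnerProductSpace ENNReal NNReal
open Literature.Analysis.FunctionSpaces Literature.Analysis.FluidPDE
open Summit.AnomalousDissipation.AnomalousDissipation.Theses.TameRoughRigidity

/-- Local notation: real vector fields on `T³`. -/
local notation "Vec3" => (UnitAddTorus (Fin 3)) → (EuclideanSpace ℝ (Fin 3))
/-- Local notation: `L²(T³; ℝ³)`. -/
local notation "L2" => (Lp (EuclideanSpace ℝ (Fin 3)) 2 (volume : Measure (UnitAddTorus (Fin 3))))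
/-- Local notation: the energy space `H`. -/
local notation "H3" => (Torus.energySpace (Fin 3))

/-! ## Stubs -/

/-- **S1 `stub_tightLimit`** — TIGHT LIMIT IN THE TAME CLASS. A sequence of Borel probability measures
on `H` with integrable energy, mean energy `≤ E` and mean enstrophy `≤ G₁` has a subsequence that
converges against every bounded continuous observable to a Borel probability measure with integrable
energy, mean energy `≤ E` and mean enstrophy `≤ G₁`. Proof plan: Chebyshev `μₙ{‖∇v‖² > M} ≤ G₁/M` and
Rellich (`Torus.isCompact_setOf_eGradNormSq_le`) give tightness; `H` is Polish
(`Lp.SecondCountableTopology`, closed subspace), so Mathlib's Prokhorov theorem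
`isCompact_closure_of_isTightMeasureSet` and the Lévy–Prokhorov metrisability of `ProbabilityMeasure H`
give a convergent subsequence (`IsCompact.tendsto_subseq`; pattern of
`Literature.Analysis.FunctionSpaces.IsPositiveDefinite.exists_charFun_eq_holds`); the energy bound passes
to the limit through the bounded continuous truncations `min(‖v‖², M)` and monotone convergence, the
enstrophy bound through the continuous truncated partial Fourier sums of the spectral enstrophy
(`Torus.eGradNormSq_eq_tsum`, `Torus.lowerSemicontinuous_eGradNormSq_coe`). Size M–L.
[FoiasManleyRosaTemam2001, Ch. IV §3.1 Prop. 3.1; Billingsley Thm. 5.1] -/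
theorem stub_tightLimit (E G₁ : ℝ) (μ : ℕ → Measure H3)
    (hprob : ∀ n, IsProbabilityMeasure (μ n))
    (hint : ∀ n, Integrable (fun v : H3 => ‖v‖ ^ 2) (μ n))
    (hE : ∀ n, Torus.ensembleEnergy (μ n) ≤ E)
    (hG : ∀ n, Torus.ensembleEnstrophy (μ n) ≤ ENNReal.ofReal G₁) :
    ∃ φ : ℕ → ℕ, StrictMono φ ∧ ∃ μ' : Measure H3, IsProbabilityMeasure μ' ∧
      Integrable (fun v : H3 => ‖v‖ ^ 2) μ' ∧ Torus.ensembleEnergy μ' ≤ E ∧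
      Torus.ensembleEnstrophy μ' ≤ ENNReal.ofReal G₁ ∧
      ∀ h : H3 → ℝ, Continuous h → (∃ C : ℝ, ∀ v, |h v| ≤ C) →
        Tendsto (fun n => ∫ v, h v ∂(μ (φ n))) atTop (𝓝 (∫ v, h v ∂μ')) := by
  sorry

/-- **S2a `stub_cutoffTest`** — THE PRODUCT CUT-OFF TEST (reshape of S2, lead 2026-08-17). For a
cylindrical `Φ` (fields `g₁…g_m`, profile `φ`), an order `K` and a level `ρ > 0` there is a cylindrical
test `Ψ` — fields `Φ.g` followed (`Fin.append`) by the Parseval frame `Torus.frameFieldIdx K ∘ (equivFin _).symm`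
of `P_K H`, profile `Π(z) = φ(z_head) · χ(|z_tail|²/ρ)` with `χ = Torus.galerkinCutoff` (head/tail through
`Fin.castAdd`/`Fin.natAdd`, e.g. as continuous linear maps, or `EuclideanSpace.finAddEquivProd`) — whose
differential is, for EVERY `v ∈ H`,
`Ψ'(v) = χ(|P_K v|²/ρ) Φ'(v) + (2/ρ) χ'(|P_K v|²/ρ) Φ(v) P_K v`
(`|P_K v|² = Torus.truncNormSq K v = Σ_p (v, e_p)²` by `Torus.sum_integral_inner_frameField_sq`,
`Σ_p (v, e_p) e_p = P_K v` by `Torus.sum_integral_inner_frameField_smul`; pattern `Torus.grad_galerkinTest`,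
`Torus.galerkinTest`, `Torus.sum_galerkinTest_eq`). Size M. [FoiasManleyRosaTemam2001, Ch. IV §1.2 p. 197; App. B.1] -/
theorem stub_cutoffTest (Φ : Torus.CylindricalTest (Fin 3)) (K : ℕ) (ρ : ℝ) (hρ : 0 < ρ) :
    ∃ Ψ : Torus.CylindricalTest (Fin 3), ∀ v : H3, Ψ.grad v = fun x =>
      (Torus.galerkinCutoff : ℝ → ℝ) (Torus.truncNormSq K v / ρ) • Φ.grad v x +
        (2 / ρ * deriv (Torus.galerkinCutoff : ℝ → ℝ) (Torus.truncNormSq K v / ρ) * Φ.eval v) •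
          Torus.fourierTruncate K (((v : L2)) : Vec3) x := by
  sorry

/-- **S2b `stub_cutoffFlux`** — GENERATOR BOOKKEEPING FOR THE CUT-OFF TEST (reshape of S2, lead
2026-08-17), a conjunction of five tools: (1) linearity of the forced-Euler generator on the two-term field
`a Φ'(v) + b P_K v` (`Torus.nsGeneratorPairing_sum_smul` over `Fin 2`, smoothness `isSmooth_grad_holds`,
`isSmooth_fourierTruncate`; the `P_K v` term is `(f, P_K v) + ∫ (v⊗v):∇P_K v`, cf.
`Torus.nsGeneratorPairing_smul_fourierTruncate`); (2) Cauchy–Schwarz `|(f, P_K v)| ≤ ‖f‖₂ |P_K v|`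
(`Torus.pairing_eq_inner`, `Torus.norm_toLp_eq_sqrt`); (3) the finite-dimensional Bernstein flux bound
`|∫ (v⊗v):∇P_K v| ≤ C_K |P_K v| |v|²` (`Torus.norm_fderiv_fourierTruncate_apply_le`: `‖D(P_K v) a‖ ≤ ‖a‖ K_K(v)`
and `K_K(v) = Σᵢ Σ_{|k|≤K} 2π|kᵢ| ‖v̂(k)‖ ≤ 6πK √N_K |P_K v|` by Cauchy–Schwarz on the finite set, with
`∫ ‖P_K v‖² = Σ_{|k|≤K} ‖v̂(k)‖²`, `Torus.integral_norm_sq_fourierTruncate`); (4) continuity of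
`v ↦ |P_K v|² = truncNormSq K v` on `H` (`Torus.continuous_mFourierCoeff_complexify_coe`); (5) Pythagoras
`∫ ‖v − P_K v‖² = |v|² − |P_K v|²` (`Torus.lintegral_enorm_sq_fourierTruncate_sub`, `Torus.enorm_sq_coe_eq_tsum`,
`Torus.integral_norm_sq_fourierTruncate`). Size M. [FoiasManleyRosaTemam2001, App. B.1 (B.10)–(B.11)] -/
theorem stub_cutoffFlux :
    (∀ (f : Vec3), Torus.IsSmooth f → ∀ (Φ : Torus.CylindricalTest (Fin 3)) (K : ℕ) (a b : ℝ) (v : H3),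
      Torus.nsGeneratorPairing 0 f v
          (fun x => a • Φ.grad v x + b • Torus.fourierTruncate K (((v : L2)) : Vec3) x) =
        a * Torus.nsGeneratorPairing 0 f v (Φ.grad v) +
          b * ((∫ x, ⟪f x, Torus.fourierTruncate K (((v : L2)) : Vec3) x⟫_ℝ) +
            Torus.inertialPairing (v : L2) (Torus.fourierTruncate K (((v : L2)) : Vec3)))) ∧
    (∀ (f : Vec3), MemLp f 2 volume → ∀ (K : ℕ) (v : H3),
      |∫ x, ⟪f x, Torus.fourierTruncate K (((v : L2)) : Vec3) x⟫_ℝ| ≤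
        Real.sqrt (∫ x, ‖f x‖ ^ 2) * Real.sqrt (Torus.truncNormSq K v)) ∧
    (∀ K : ℕ, ∃ C : ℝ, 0 ≤ C ∧ ∀ v : H3,
      |Torus.inertialPairing (v : L2) (Torus.fourierTruncate K (((v : L2)) : Vec3))| ≤
        C * Real.sqrt (Torus.truncNormSq K v) * ‖v‖ ^ 2) ∧
    (∀ K : ℕ, Continuous fun v : H3 => Torus.truncNormSq K v) ∧
    (∀ (K : ℕ) (v : H3),
      ∫ x, ‖(((v : L2)) : Vec3) x - Torus.fourierTruncate K (((v : L2)) : Vec3) x‖ ^ 2 =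
        ‖v‖ ^ 2 - Torus.truncNormSq K v) := by
  sorry

/-- **S2c `stub_projectedStress`** — THE GALERKIN-PROJECTED REYNOLDS STRESS AND THE SPECTRAL TAIL
(reshape of S2, lead 2026-08-17). (1) For a smooth field `g` there is `C ≥ 0` (twice a bound on `Σⱼ‖∂ⱼg‖`,
`Torus.exists_sum_norm_partialDeriv_le`) such that for every order `K` the projected stress
`q(v) = ∫ (P_K v ⊗ P_K v):∇g = Σ_{p,q} (v,e_p)(v,e_q) ∫ ⟪(∇g) e_p, e_q⟫` (frame expansion — manifestly
continuous, `Torus.continuous_pairing_coe`) satisfies `|q(v)| ≤ B |P_K v|²` and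
`|∫ (v⊗v):∇g − q(v)| = |∫ ⟪(∇g)v, v − P_K v⟫ + ∫ ⟪(∇g)(v − P_K v), P_K v⟫| ≤ C |v| ‖v − P_K v‖₂`
(`Torus.integrable_inner_fderiv_apply_coe`); (2) the pointwise spectral tail bound
`4π²(K²+1) ∫ ‖v − P_K v‖² ≤ ‖∇v‖²` in `ℝ≥0∞` (`Torus.lintegral_enorm_sq_fourierTruncate_sub_le`,
`Torus.tailGradNormSq_le`, `Torus.ofReal_integral_norm_sq_eq_lintegral`). Size M.
[FoiasManleyRosaTemam2001, Ch. IV (1.14) p. 193; App. B.1] -/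
theorem stub_projectedStress :
    (∀ (g : Vec3), Torus.IsSmooth g → ∃ C : ℝ, 0 ≤ C ∧ ∀ K : ℕ, ∃ (q : H3 → ℝ) (B : ℝ),
      Continuous q ∧ (∀ v : H3, |q v| ≤ B * Torus.truncNormSq K v) ∧
      ∀ v : H3, |Torus.inertialPairing (v : L2) g - q v| ≤
        C * ‖v‖ * Real.sqrt (∫ x, ‖(((v : L2)) : Vec3) x - Torus.fourierTruncate K (((v : L2)) : Vec3) x‖ ^ 2)) ∧
    (∀ (K : ℕ) (v : H3),
      ENNReal.ofReal (4 * Real.pi ^ 2 * ((K : ℝ) ^ 2 + 1)) *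
          ENNReal.ofReal (∫ x, ‖(((v : L2)) : Vec3) x - Torus.fourierTruncate K (((v : L2)) : Vec3) x‖ ^ 2) ≤
        Torus.eGradNormSq (((v : L2)) : Vec3)) := by
  sorry

/-- **S2d `stub_cutoffAssembly`** — THE CUT-OFF SCHEME ON THE TAME CLASS FROM THE THREE TOOLS (reshape of
S2, lead 2026-08-17; the lead's own stub). From S2a (product test + differential), S2b (generator bookkeeping,
Bernstein flux bound, Pythagoras) and S2c (projected stress, spectral tail) — taken as hypotheses VERBATIM —
the registered cut-off scheme follows: given `ε`, choose `K` with `C_Φ √E⁺ √(G₁⁺/(4π²(K²+1))) ≤ ε/3`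
(`C_Φ = Σᵢ M Cᵢ`, `M` from `CylindricalTest.exists_abs_fderiv_coords_le`), then `ρ₀ ≥ 1` with
`2√2 ‖χ'‖_∞ ‖φ‖_∞ (‖f‖₂ + C_K E⁺)/√ρ₀ ≤ ε/3`; for `ρ ≥ ρ₀`: `c = χ(|P_K v|²/ρ)`,
`h = c · Σᵢ ∂ᵢφ(coords v) [(f, gᵢ) + qᵢ(v)]` (bounded: `|P_K v|² < 2ρ` on `{c ≠ 0}`), `Ψ` from S2a,
`δ = ε / (3 (√C_Ψ + 1))` with `‖∇Ψ'(v)‖² ≤ C_Ψ` (`ResidualTransferSSS.stub_testEnstrophyTame`). First clause: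
`|c L₀Φ − h| ≤ C_Φ |v| √(|v|² − |P_K v|²)` pointwise, Cauchy–Schwarz in `ν` and the integrated tail
`∫ (|v|² − |P_K v|²) dν ≤ G₁⁺/(4π²(K²+1))` (S2c(2) integrated against `ensembleEnstrophy ν ≤ ofReal G₁`). Second
clause: `L₀Ψ = c L₀Φ + flux` (S2a + S2b(1)), `|∫ flux dν| ≤ ε/3` (S2b(2)(3), `χ' = 0` off `1 < t < 2`,
`∫ |v|² dν ≤ E`), `|∫ L₀Ψ dν| ≤ δ √C_Ψ ≤ ε/3`. Size L (bookkeeping only). [FoiasManleyRosaTemam2001, App. B.1–B.2] -/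
theorem stub_cutoffAssembly
    (hA : ∀ (Φ : Torus.CylindricalTest (Fin 3)) (K : ℕ) (ρ : ℝ), 0 < ρ →
      ∃ Ψ : Torus.CylindricalTest (Fin 3), ∀ v : H3, Ψ.grad v = fun x =>
        (Torus.galerkinCutoff : ℝ → ℝ) (Torus.truncNormSq K v / ρ) • Φ.grad v x +
          (2 / ρ * deriv (Torus.galerkinCutoff : ℝ → ℝ) (Torus.truncNormSq K v / ρ) * Φ.eval v) •
            Torus.fourierTruncate K (((v : L2)) : Vec3) x)
    (hB : (∀ (f : Vec3), Torus.IsSmooth f → ∀ (Φ : Torus.CylindricalTest (Fin 3)) (K : ℕ) (a b : ℝ) (v : H3),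
        Torus.nsGeneratorPairing 0 f v
            (fun x => a • Φ.grad v x + b • Torus.fourierTruncate K (((v : L2)) : Vec3) x) =
          a * Torus.nsGeneratorPairing 0 f v (Φ.grad v) +
            b * ((∫ x, ⟪f x, Torus.fourierTruncate K (((v : L2)) : Vec3) x⟫_ℝ) +
              Torus.inertialPairing (v : L2) (Torus.fourierTruncate K (((v : L2)) : Vec3)))) ∧
      (∀ (f : Vec3), MemLp f 2 volume → ∀ (K : ℕ) (v : H3),
        |∫ x, ⟪f x, Torus.fourierTruncate K (((v : L2)) : Vec3) x⟫_ℝ| ≤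
          Real.sqrt (∫ x, ‖f x‖ ^ 2) * Real.sqrt (Torus.truncNormSq K v)) ∧
      (∀ K : ℕ, ∃ C : ℝ, 0 ≤ C ∧ ∀ v : H3,
        |Torus.inertialPairing (v : L2) (Torus.fourierTruncate K (((v : L2)) : Vec3))| ≤
          C * Real.sqrt (Torus.truncNormSq K v) * ‖v‖ ^ 2) ∧
      (∀ K : ℕ, Continuous fun v : H3 => Torus.truncNormSq K v) ∧
      (∀ (K : ℕ) (v : H3),
        ∫ x, ‖(((v : L2)) : Vec3) x - Torus.fourierTruncate K (((v : L2)) : Vec3) x‖ ^ 2 =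
          ‖v‖ ^ 2 - Torus.truncNormSq K v))
    (hC : (∀ (g : Vec3), Torus.IsSmooth g → ∃ C : ℝ, 0 ≤ C ∧ ∀ K : ℕ, ∃ (q : H3 → ℝ) (B : ℝ),
        Continuous q ∧ (∀ v : H3, |q v| ≤ B * Torus.truncNormSq K v) ∧
        ∀ v : H3, |Torus.inertialPairing (v : L2) g - q v| ≤
          C * ‖v‖ * Real.sqrt (∫ x, ‖(((v : L2)) : Vec3) x - Torus.fourierTruncate K (((v : L2)) : Vec3) x‖ ^ 2)) ∧
      (∀ (K : ℕ) (v : H3),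
        ENNReal.ofReal (4 * Real.pi ^ 2 * ((K : ℝ) ^ 2 + 1)) *
            ENNReal.ofReal (∫ x, ‖(((v : L2)) : Vec3) x - Torus.fourierTruncate K (((v : L2)) : Vec3) x‖ ^ 2) ≤
          Torus.eGradNormSq (((v : L2)) : Vec3)))
    (f : Vec3) (hf : Torus.IsSmooth f) (Φ : Torus.CylindricalTest (Fin 3))
    (E G₁ ε : ℝ) (hε : 0 < ε) :
    ∃ ρ₀ : ℝ, ∀ ρ : ℝ, ρ₀ ≤ ρ →
      ∃ (c h : H3 → ℝ) (Ψ : Torus.CylindricalTest (Fin 3)) (δ : ℝ), 0 < δ ∧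
        Continuous c ∧ Continuous h ∧ (∀ v, 0 ≤ c v ∧ c v ≤ 1) ∧ (∀ v : H3, ‖v‖ ^ 2 ≤ ρ → c v = 1) ∧
        (∃ C : ℝ, ∀ v, |h v| ≤ C) ∧
        ∀ ν : Measure H3, IsProbabilityMeasure ν → Integrable (fun v : H3 => ‖v‖ ^ 2) ν →
          Torus.ensembleEnergy ν ≤ E → Torus.ensembleEnstrophy ν ≤ ENNReal.ofReal G₁ →
          |(∫ v, c v * Torus.nsGeneratorPairing 0 f v (Φ.grad v) ∂ν) - ∫ v, h v ∂ν| ≤ ε ∧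
          (|∫ v, Torus.nsGeneratorPairing 0 f v (Ψ.grad v) ∂ν| ≤
              δ * Real.sqrt (∫ v, Torus.gradNormSq (Ψ.grad v) ∂ν) →
            |∫ v, c v * Torus.nsGeneratorPairing 0 f v (Φ.grad v) ∂ν| ≤ ε) := by
  sorry

/-- **S2 (no longer a stub): the cut-off scheme on the tame class**, with the registered S2 signature, from
the four registered pieces S2a–S2d (one line). -/
theorem cutoffScheme_of_pieces (f : Vec3) (hf : Torus.IsSmooth f) (Φ : Torus.CylindricalTest (Fin 3))
    (E G₁ ε : ℝ) (hε : 0 < ε) :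
    ∃ ρ₀ : ℝ, ∀ ρ : ℝ, ρ₀ ≤ ρ →
      ∃ (c h : H3 → ℝ) (Ψ : Torus.CylindricalTest (Fin 3)) (δ : ℝ), 0 < δ ∧
        Continuous c ∧ Continuous h ∧ (∀ v, 0 ≤ c v ∧ c v ≤ 1) ∧ (∀ v : H3, ‖v‖ ^ 2 ≤ ρ → c v = 1) ∧
        (∃ C : ℝ, ∀ v, |h v| ≤ C) ∧
        ∀ ν : Measure H3, IsProbabilityMeasure ν → Integrable (fun v : H3 => ‖v‖ ^ 2) ν →
          Torus.ensembleEnergy ν ≤ E → Torus.ensembleEnstrophy ν ≤ ENNReal.ofReal G₁ →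
          |(∫ v, c v * Torus.nsGeneratorPairing 0 f v (Φ.grad v) ∂ν) - ∫ v, h v ∂ν| ≤ ε ∧
          (|∫ v, Torus.nsGeneratorPairing 0 f v (Ψ.grad v) ∂ν| ≤
              δ * Real.sqrt (∫ v, Torus.gradNormSq (Ψ.grad v) ∂ν) →
            |∫ v, c v * Torus.nsGeneratorPairing 0 f v (Φ.grad v) ∂ν| ≤ ε) :=
  stub_cutoffAssembly stub_cutoffTest stub_cutoffFlux stub_projectedStress f hf Φ E G₁ ε hε

/-- **S3 `stub_limitExact`** — THE ABSTRACT LIMIT LEMMA (pure measure theory on the metric space `H`).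
Let `μₙ → μ'` against bounded continuous observables, all probability measures, `μ'` with integrable
energy; let `F : H → ℝ` be continuous with `|F(v)| ≤ A(1 + |v|²)`. If for every `ε > 0` there is `ρ₀`
such that for every `ρ ≥ ρ₀` a continuous cut-off `c : H → [0,1]`, `c = 1` on `{|v|² ≤ ρ}`, and a bounded
continuous `h` exist with `|∫ cF dμ' − ∫ h dμ'| ≤ ε`, `|∫ cF dμₙ − ∫ h dμₙ| ≤ ε` for all `n`, and
`|∫ cF dμₙ| ≤ ε` eventually, then `F ∈ L¹(μ')` and `∫ F dμ' = 0`. Proof plan: integrability from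
continuity and the quadratic bound; `∫ (1 − c)|F| dμ' ≤ ∫_{|v|² > ρ} A(1+|v|²) dμ' → 0` as `ρ → ∞`
(dominated convergence for the single measure `μ'`), then
`|∫ F dμ'| ≤ ε + |∫ h dμ'| + ε = 2ε + lim |∫ h dμₙ| ≤ 2ε + limsup (|∫ cF dμₙ| + ε) ≤ 4ε`. Size M.
[Billingsley, *Convergence of Probability Measures*, §3 (uniform integrability and weak limits)] -/
theorem stub_limitExact (μ : ℕ → Measure H3) (μ' : Measure H3)
    (hprob : ∀ n, IsProbabilityMeasure (μ n)) (hprob' : IsProbabilityMeasure μ')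
    (hweak : ∀ h : H3 → ℝ, Continuous h → (∃ C : ℝ, ∀ v, |h v| ≤ C) →
      Tendsto (fun n => ∫ v, h v ∂(μ n)) atTop (𝓝 (∫ v, h v ∂μ')))
    (hint' : Integrable (fun v : H3 => ‖v‖ ^ 2) μ')
    (F : H3 → ℝ) (hFc : Continuous F) (A : ℝ) (hFA : ∀ v, |F v| ≤ A * (1 + ‖v‖ ^ 2))
    (hscheme : ∀ ε : ℝ, 0 < ε → ∃ ρ₀ : ℝ, ∀ ρ : ℝ, ρ₀ ≤ ρ →
      ∃ (c h : H3 → ℝ), Continuous c ∧ Continuous h ∧ (∀ v, 0 ≤ c v ∧ c v ≤ 1) ∧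
        (∀ v : H3, ‖v‖ ^ 2 ≤ ρ → c v = 1) ∧ (∃ C : ℝ, ∀ v, |h v| ≤ C) ∧
        |(∫ v, c v * F v ∂μ') - ∫ v, h v ∂μ'| ≤ ε ∧
        (∀ n, |(∫ v, c v * F v ∂(μ n)) - ∫ v, h v ∂(μ n)| ≤ ε) ∧
        (∀ᶠ n in atTop, |∫ v, c v * F v ∂(μ n)| ≤ ε)) :
    Integrable F μ' ∧ ∫ v, F v ∂μ' = 0 := by
  sorry

/-- **S4 `stub_symmetrise`** — TIME-REVERSAL NORMAL FORM OF THE LIMIT. For a smooth force `f`, a Borel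
probability measure on `H` with integrable energy `≤ E`, mean enstrophy `≤ G₁` and the EXACT cylindrical
Liouville identity `∫ ⟨f − B(v,v), Φ'(v)⟩ dμ = 0` (all cylindrical `Φ`) yields a stationary statistical
solution of the Euler equations forced by `f` in the FMRT class with the same bounds: the symmetrised
measure `μ' = ½(μ + (v ↦ −v)_*μ)` has the same energy and enstrophy (`‖∇(−v)‖ = ‖∇v‖`,
`desaturation_eGradNormSq_neg`), still satisfies the identity (`⟨F₀(−v), w⟩ = ⟨F₀(v), w⟩`,
`⟨F₀(v), −w⟩ = −⟨F₀(v), w⟩`, reflected test `desaturation_exists_reflect`), has finite mean enstrophy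
(`≤ ofReal G₁ < ⊤`) and ZERO work `∫_{shell} (v, f) dμ' = 0` on every energy shell (the pairing is odd,
shells are even), which at `ν = 0` is the shell energy inequality (1.31). Pattern: `stub_desaturation`
(`Theorems/EnsembleRigidityGPStatisticalRigidityDesaturation.lean`, landed p130125). Size M.
[FoiasManleyRosaTemam2001, Ch. IV §1.2 Def. 1.3 (1.29)–(1.31)] -/
theorem stub_symmetrise (f : Vec3) (hf : Torus.IsSmooth f) (E G₁ : ℝ) (μ : Measure H3)
    (hprob : IsProbabilityMeasure μ) (hint : Integrable (fun v : H3 => ‖v‖ ^ 2) μ)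
    (hE : Torus.ensembleEnergy μ ≤ E) (hG : Torus.ensembleEnstrophy μ ≤ ENNReal.ofReal G₁)
    (hgen : ∀ Φ : Torus.CylindricalTest (Fin 3),
      Integrable (fun v : H3 => Torus.nsGeneratorPairing 0 f v (Φ.grad v)) μ ∧
        ∫ v, Torus.nsGeneratorPairing 0 f v (Φ.grad v) ∂μ = 0) :
    ∃ μ' : Measure H3, Torus.IsStationaryStatisticalSolution 0 f μ' ∧
      Integrable (fun v : H3 => ‖v‖ ^ 2) μ' ∧ Torus.ensembleEnergy μ' ≤ E ∧
      Torus.ensembleEnstrophy μ' ≤ ENNReal.ofReal G₁ := by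
  sorry

/-! ## Composition (sorry-free) -/

/-- **Tame closure for EVERY smooth force, from the four pieces** (SORRY-FREE; the implication content
of the skeleton; its conclusion is the body of the crux with the pin `f = f_GP` relaxed to `f` smooth, so
that `TameClosure_of` below is the only theorem whose type is the crux decl). Hypotheses: the statements
of S1–S4 verbatim. Proof: choose approximants `μₙ` at defect radius `rₙ = 1/(n+1)`; S1 gives a
subsequence `φ` and a tame weak limit `μ'`; for each cylindrical `Φ`, S3 — with `F = L₀Φ` (continuous
with quadratic growth by `Torus.continuous_nsGeneratorPairing_grad`,
`Torus.exists_abs_nsGeneratorPairing_grad_le`) and the scheme of S2 evaluated on `μ'` and on the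
`μ_{φ n}` (all in the tame class), the eventual clause firing once `1/(φ n + 1) ≤ δ` — gives the
Liouville identity of `μ'`; S4 turns `μ'` into an FMRT stationary statistical solution with the same
bounds. -/
theorem tameClosureSmooth_of_pieces
    (hS1 : ∀ (E G₁ : ℝ) (μ : ℕ → Measure H3),
      (∀ n, IsProbabilityMeasure (μ n)) → (∀ n, Integrable (fun v : H3 => ‖v‖ ^ 2) (μ n)) →
      (∀ n, Torus.ensembleEnergy (μ n) ≤ E) → (∀ n, Torus.ensembleEnstrophy (μ n) ≤ ENNReal.ofReal G₁) →
      ∃ φ : ℕ → ℕ, StrictMono φ ∧ ∃ μ' : Measure H3, IsProbabilityMeasure μ' ∧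
        Integrable (fun v : H3 => ‖v‖ ^ 2) μ' ∧ Torus.ensembleEnergy μ' ≤ E ∧
        Torus.ensembleEnstrophy μ' ≤ ENNReal.ofReal G₁ ∧
        ∀ h : H3 → ℝ, Continuous h → (∃ C : ℝ, ∀ v, |h v| ≤ C) →
          Tendsto (fun n => ∫ v, h v ∂(μ (φ n))) atTop (𝓝 (∫ v, h v ∂μ')))
    (hS2 : ∀ (f : Vec3), Torus.IsSmooth f → ∀ (Φ : Torus.CylindricalTest (Fin 3)) (E G₁ ε : ℝ), 0 < ε →
      ∃ ρ₀ : ℝ, ∀ ρ : ℝ, ρ₀ ≤ ρ →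
        ∃ (c h : H3 → ℝ) (Ψ : Torus.CylindricalTest (Fin 3)) (δ : ℝ), 0 < δ ∧
          Continuous c ∧ Continuous h ∧ (∀ v, 0 ≤ c v ∧ c v ≤ 1) ∧ (∀ v : H3, ‖v‖ ^ 2 ≤ ρ → c v = 1) ∧
          (∃ C : ℝ, ∀ v, |h v| ≤ C) ∧
          ∀ ν : Measure H3, IsProbabilityMeasure ν → Integrable (fun v : H3 => ‖v‖ ^ 2) ν →
            Torus.ensembleEnergy ν ≤ E → Torus.ensembleEnstrophy ν ≤ ENNReal.ofReal G₁ →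
            |(∫ v, c v * Torus.nsGeneratorPairing 0 f v (Φ.grad v) ∂ν) - ∫ v, h v ∂ν| ≤ ε ∧
            (|∫ v, Torus.nsGeneratorPairing 0 f v (Ψ.grad v) ∂ν| ≤
                δ * Real.sqrt (∫ v, Torus.gradNormSq (Ψ.grad v) ∂ν) →
              |∫ v, c v * Torus.nsGeneratorPairing 0 f v (Φ.grad v) ∂ν| ≤ ε))
    (hS3 : ∀ (μ : ℕ → Measure H3) (μ' : Measure H3),
      (∀ n, IsProbabilityMeasure (μ n)) → IsProbabilityMeasure μ' →
      (∀ h : H3 → ℝ, Continuous h → (∃ C : ℝ, ∀ v, |h v| ≤ C) →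
        Tendsto (fun n => ∫ v, h v ∂(μ n)) atTop (𝓝 (∫ v, h v ∂μ'))) →
      Integrable (fun v : H3 => ‖v‖ ^ 2) μ' →
      ∀ (F : H3 → ℝ), Continuous F → ∀ (A : ℝ), (∀ v, |F v| ≤ A * (1 + ‖v‖ ^ 2)) →
      (∀ ε : ℝ, 0 < ε → ∃ ρ₀ : ℝ, ∀ ρ : ℝ, ρ₀ ≤ ρ →
        ∃ (c h : H3 → ℝ), Continuous c ∧ Continuous h ∧ (∀ v, 0 ≤ c v ∧ c v ≤ 1) ∧
          (∀ v : H3, ‖v‖ ^ 2 ≤ ρ → c v = 1) ∧ (∃ C : ℝ, ∀ v, |h v| ≤ C) ∧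
          |(∫ v, c v * F v ∂μ') - ∫ v, h v ∂μ'| ≤ ε ∧
          (∀ n, |(∫ v, c v * F v ∂(μ n)) - ∫ v, h v ∂(μ n)| ≤ ε) ∧
          (∀ᶠ n in atTop, |∫ v, c v * F v ∂(μ n)| ≤ ε)) →
      Integrable F μ' ∧ ∫ v, F v ∂μ' = 0)
    (hS4 : ∀ (f : Vec3), Torus.IsSmooth f → ∀ (E G₁ : ℝ) (μ : Measure H3),
      IsProbabilityMeasure μ → Integrable (fun v : H3 => ‖v‖ ^ 2) μ →
      Torus.ensembleEnergy μ ≤ E → Torus.ensembleEnstrophy μ ≤ ENNReal.ofReal G₁ →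
      (∀ Φ : Torus.CylindricalTest (Fin 3),
        Integrable (fun v : H3 => Torus.nsGeneratorPairing 0 f v (Φ.grad v)) μ ∧
          ∫ v, Torus.nsGeneratorPairing 0 f v (Φ.grad v) ∂μ = 0) →
      ∃ μ' : Measure H3, Torus.IsStationaryStatisticalSolution 0 f μ' ∧
        Integrable (fun v : H3 => ‖v‖ ^ 2) μ' ∧ Torus.ensembleEnergy μ' ≤ E ∧
        Torus.ensembleEnstrophy μ' ≤ ENNReal.ofReal G₁)
    (f : Vec3) (hfs : Torus.IsSmooth f) (E G₁ : ℝ)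
    (hnear : ∀ r : ℝ, 0 < r → ∃ μ : Measure H3, IsProbabilityMeasure μ ∧
      Integrable (fun v : H3 => ‖v‖ ^ 2) μ ∧ Torus.ensembleEnergy μ ≤ E ∧
      Torus.ensembleEnstrophy μ ≤ ENNReal.ofReal G₁ ∧
      (∀ Φ : Torus.CylindricalTest (Fin 3),
        Integrable (fun v : H3 => Torus.nsGeneratorPairing 0 f v (Φ.grad v)) μ ∧
          |∫ v, Torus.nsGeneratorPairing 0 f v (Φ.grad v) ∂μ| ≤
            r * Real.sqrt (∫ v, Torus.gradNormSq (Φ.grad v) ∂μ))) :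
    ∃ μ : Measure H3, Torus.IsStationaryStatisticalSolution 0 f μ ∧
      Integrable (fun v : H3 => ‖v‖ ^ 2) μ ∧ Torus.ensembleEnergy μ ≤ E ∧
      Torus.ensembleEnstrophy μ ≤ ENNReal.ofReal G₁ := by
  -- approximants at defect radius `1/(n+1)`
  have hex : ∀ n : ℕ, ∃ μ : Measure H3, IsProbabilityMeasure μ ∧
      Integrable (fun v : H3 => ‖v‖ ^ 2) μ ∧ Torus.ensembleEnergy μ ≤ E ∧
      Torus.ensembleEnstrophy μ ≤ ENNReal.ofReal G₁ ∧
      (∀ Φ : Torus.CylindricalTest (Fin 3),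
        Integrable (fun v : H3 => Torus.nsGeneratorPairing 0 f v (Φ.grad v)) μ ∧
          |∫ v, Torus.nsGeneratorPairing 0 f v (Φ.grad v) ∂μ| ≤
            (1 / ((n : ℝ) + 1)) * Real.sqrt (∫ v, Torus.gradNormSq (Φ.grad v) ∂μ)) :=
    fun n => hnear (1 / ((n : ℝ) + 1)) (by positivity)
  choose μ hμ using hex
  -- S1: a tame weak limit along a subsequence
  obtain ⟨φ, hφ, μ', hprob', hint', hE', hG', hweak⟩ :=
    hS1 E G₁ μ (fun n => (hμ n).1) (fun n => (hμ n).2.1) (fun n => (hμ n).2.2.1)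
      (fun n => (hμ n).2.2.2.1)
  -- S3 fed by S2: the exact cylindrical Liouville identity of the limit
  have hgen : ∀ Φ : Torus.CylindricalTest (Fin 3),
      Integrable (fun v : H3 => Torus.nsGeneratorPairing 0 f v (Φ.grad v)) μ' ∧
        ∫ v, Torus.nsGeneratorPairing 0 f v (Φ.grad v) ∂μ' = 0 := by
    intro Φ
    obtain ⟨A, -, hA⟩ := Torus.exists_abs_nsGeneratorPairing_grad_le 0 (hfs.memLp 2) Φ
    refine hS3 (fun n => μ (φ n)) μ' (fun n => (hμ (φ n)).1) hprob' hweak hint'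
      (fun v => Torus.nsGeneratorPairing 0 f v (Φ.grad v))
      (Torus.continuous_nsGeneratorPairing_grad 0 ((hfs.memLp 2).integrable one_le_two) Φ) A hA ?_
    intro ε hε
    obtain ⟨ρ₀, hρ₀⟩ := hS2 f hfs Φ E G₁ ε hε
    refine ⟨ρ₀, fun ρ hρ => ?_⟩
    obtain ⟨c, h, Ψ, δ, hδ, hc, hh, hc01, hc1, hhb, hclass⟩ := hρ₀ ρ hρ
    refine ⟨c, h, hc, hh, hc01, hc1, hhb, (hclass μ' hprob' hint' hE' hG').1, fun n =>
      (hclass (μ (φ n)) (hμ (φ n)).1 (hμ (φ n)).2.1 (hμ (φ n)).2.2.1 (hμ (φ n)).2.2.2.1).1, ?_⟩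
    -- eventually the defect radius `1/(φ n + 1)` is below `δ`
    obtain ⟨N, hN⟩ := exists_nat_gt (1 / δ)
    refine Filter.eventually_atTop.2 ⟨N, fun n hn => ?_⟩
    have hμn := hμ (φ n)
    refine (hclass (μ (φ n)) hμn.1 hμn.2.1 hμn.2.2.1 hμn.2.2.2.1).2 ?_
    obtain ⟨-, hdef⟩ := hμn.2.2.2.2 Ψ
    refine hdef.trans (mul_le_mul_of_nonneg_right ?_ (Real.sqrt_nonneg _))
    have h1 : (N : ℝ) ≤ (φ n : ℝ) := Nat.cast_le.2 (hn.trans (hφ.id_le n))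
    have hpos : (0 : ℝ) < (φ n : ℝ) + 1 := by positivity
    have h2 : 1 / δ < (φ n : ℝ) + 1 := by linarith
    have h3 : 1 < ((φ n : ℝ) + 1) * δ := (div_lt_iff₀ hδ).1 h2
    rw [div_le_iff₀ hpos]
    linarith [h3, mul_comm ((φ n : ℝ) + 1) δ]
  -- S4: symmetrise the limit into an FMRT stationary statistical solution with the same bounds
  exact hS4 f hfs E G₁ μ' hprob' hint' hE' hG' hgen

/-- **The crux BY NAME** — `TameRoughRigidity.TameClosure` from the four registered stubs through the
sorry-free composition `tameClosureSmooth_of_pieces`; the pinned force is smooth by the landed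
`SteadyStatesLoudBounded.GpAdmissible.stub_gpAdmissible` (stated on the same inline expression). Its only
non-whitelisted axiom is the `sorryAx` of the stubs; it closes the crux the day S1–S4 land. -/
theorem TameClosure_of : TameClosure := by
  intro f hf E G₁ hnear
  have hfs : Torus.IsSmooth f := by
    rw [hf]
    exact Summit.AnomalousDissipation.AnomalousDissipation.Theorems.SteadyStatesLoudBounded.GpAdmissible.stub_gpAdmissible.1
  exact tameClosureSmooth_of_pieces stub_tightLimit cutoffScheme_of_pieces stub_limitExact stub_symmetrise
    f hfs E G₁ hnear

end Summit.AnomalousDissipation.AnomalousDissipation.Cruxes.TameClosure.CutoffCompactness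

end
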